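import Literature.Barriers.Schanuel.NesterenkoModularScopeQSeries
import Mathlib.NumberTheory.ModularForms.LevelOne.DimensionFormula
import Mathlib.NumberTheory.ModularForms.EisensteinSeries.E2.Summable
import HarnessLib

/-!
# Barrier (Schanuel) `NesterenkoModularScope`: Serre derivatives of level-one modular forms are modular forms — proofs only

`Literature/Barriers/Schanuel/NesterenkoModularScopeSerreForms.lean` — sibling proofs file of
`NesterenkoModularScope.lean` (barrier `NesterenkoModularScope := nesterenko1996_thm_1_1`,
LNM 1752 Ch. 3 Theorem 1.1). No new definitions; proofs only (existence statements). Second step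
towards discharging the named fact `ramanujan1916_system` (Ramanujan's system (2)) from Mathlib's
level-one modular forms (the route of Serre, *Cours d'arithmétique* VII.4, and of Mathlib's
`Mathlib.NumberTheory.ModularForms.Derivative`, whose TODO this carries out):

* `exists_levelOne_modularForm` — a function on `ℍ` invariant under `SL(2, ℤ)` in weight `k`,
  holomorphic and bounded at `i∞` is (the coercion of) a `ModularForm 𝒮ℒ k`;
* `hasSum_qExpansion_levelOne`, `hasSum_E2_qParam` — the `q`-expansions of level-one forms and
  of `E₂` in the `∑ c_m q^m` form of `NesterenkoModularScopeQSeries.lean`;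
* `exists_serreDerivative_modularForm` — **for `f ∈ M_k(SL₂(ℤ))` the Serre derivative
  `∂_k f = D f − (k/12) E₂ f` is in `M_{k+2}(SL₂(ℤ))`** (slash-equivariance of `∂_k` is Mathlib's
  `Derivative.serreDerivative_slash_invariant`; holomorphy is Mathlib's; boundedness at `i∞`
  because `D f` is again a convergent `q`-series), together with its `q`-expansion
  `∂_k f = ∑ (m a_m − (k/12) ∑_{i+j=m} e_i a_j) q^m` (`hasSum_serreDerivative`);
* `qExpansion_coeff_eq_mul_of_rank_one` — in a weight with `dim M_k = 1` and a form `h` with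
  constant term `1`, every form `g` satisfies `ĝ(m) = ĝ(0) ĥ(m)` coefficientwise.

## References

* J.-P. Serre, *A Course in Arithmetic*, GTM 7, Springer 1973, Ch. VII §4.1 (the operator `θ`
  and `∂`), Theorem 4 (dimensions). [folklore]
* [NesterenkoPhilippon2001] LNM 1752 (2001), Ch. 3 §1 (2).
-/

noncomputable section

open Complex Filter Topology Finset ModularForm EisensteinSeries Matrix.SpecialLinearGroup
open UpperHalfPlane hiding I
open scoped Real Manifold MatrixGroups

namespace Literature.Barriers.Schanuel

/-! ### Level-one modular forms from the three defining properties -/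

/-- A level-one modular form is invariant under every `γ ∈ SL(2, ℤ)`. [folklore] -/
theorem levelOne_slash_eq {k : ℤ} (f : ModularForm 𝒮ℒ k) (γ : SL(2, ℤ)) :
    (⇑f) ∣[k] γ = ⇑f := by
  rw [ModularForm.SL_slash]
  exact SlashInvariantFormClass.slash_action_eq f _ ⟨γ, rfl⟩

/-- **A function on `ℍ` invariant under `SL(2, ℤ)` in weight `k`, holomorphic and bounded at
`i∞`, is a level-one modular form of weight `k`** (boundedness at the unique cusp follows from
invariance). [folklore] -/
theorem exists_levelOne_modularForm {k : ℤ} {g : ℍ → ℂ} (hslash : ∀ γ : SL(2, ℤ), g ∣[k] γ = g)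
    (hmd : MDifferentiable 𝓘(ℂ) 𝓘(ℂ) g) (hbdd : IsBoundedAtImInfty g) :
    ∃ F : ModularForm 𝒮ℒ k, ⇑F = g := by
  refine ⟨{ toFun := g
            slash_action_eq' := fun γ hγ => ?_
            holo' := hmd
            bdd_at_cusps' := fun hc => ?_ }, rfl⟩
  · obtain ⟨γ', rfl⟩ := hγ
    have h := hslash γ'
    rwa [ModularForm.SL_slash] at h
  · exact (OnePoint.isBoundedAt_iff_forall_SL2Z hc).mpr fun γ _ => by
      rw [hslash γ]; exact hbdd

/-! ### `q`-expansions of level-one forms and of `E₂` -/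

/-- The `q`-expansion of a level-one modular form: `f(τ) = ∑ f̂(m) q^m`, `q = e^{2πiτ}`.
[folklore] -/
theorem hasSum_qExpansion_levelOne {k : ℤ} (f : ModularForm 𝒮ℒ k) (τ : ℍ) :
    HasSum (fun m => (qExpansion 1 f).coeff m * Function.Periodic.qParam 1 (τ : ℂ) ^ m) (f τ) := by
  simpa only [smul_eq_mul] using hasSum_qExpansion one_pos
    (SlashInvariantFormClass.periodic_comp_ofComplex f one_mem_strictPeriods_SL) f.holo'
    (ModularFormClass.bdd_at_infty f) τ

/-- The `q`-expansion coefficients of `E₂ = 1 − 24 ∑ σ₁(m) q^m`. [folklore] -/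
theorem hasSum_E2_qParam (τ : ℍ) :
    HasSum (fun m => (if m = 0 then 1 else -24 * (ArithmeticFunction.sigma 1 m : ℂ)) *
      Function.Periodic.qParam 1 (τ : ℂ) ^ m) (E2 τ) := by
  have h := hasSum_qExpansion_E2 (z := τ)
  simpa only [smul_eq_mul, Function.Periodic.qParam, ofReal_one, div_one] using h

/-- `E₂` is holomorphic (Mathlib) and bounded at `i∞` (Mathlib). [folklore] -/
theorem isBoundedAtImInfty_E2_mul {k : ℤ} (f : ModularForm 𝒮ℒ k) (a : ℂ) :
    IsBoundedAtImInfty (fun z : ℍ => a * E2 z * f z) := by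
  have h := ((Filter.const_boundedAtFilter atImInfty a).mul isBoundedAtImInfty_E2).mul
    (ModularFormClass.bdd_at_infty f)
  exact h

/-! ### The Serre derivative of a level-one form is a level-one form -/

/-- `∂_k f = D f − (k/12) E₂ f` is bounded at `i∞` for a level-one modular form `f`
(`D f` is again a convergent `q`-series). [folklore] -/
theorem isBoundedAtImInfty_serreDerivative {k : ℤ} (f : ModularForm 𝒮ℒ k) :
    IsBoundedAtImInfty (Derivative.serreDerivative k f) := by
  have hD := isBoundedAtImInfty_normalizedDeriv_of_hasSum_qParam (hasSum_qExpansion_levelOne f)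
  have hE := isBoundedAtImInfty_E2_mul f ((k : ℂ) * 12⁻¹)
  have h := hD.sub hE
  rw [Derivative.serreDerivative_eq]
  exact h

/-- **The Serre derivative of a level-one modular form of weight `k` is a level-one modular form
of weight `k + 2`** (Serre, *Cours d'arithmétique* VII.4; Mathlib TODO in
`Mathlib.NumberTheory.ModularForms.Derivative`). [folklore] -/
theorem exists_serreDerivative_modularForm {k : ℤ} (f : ModularForm 𝒮ℒ k) :
    ∃ F : ModularForm 𝒮ℒ (k + 2), ⇑F = Derivative.serreDerivative k f :=
  exists_levelOne_modularForm
    (fun γ => Derivative.serreDerivative_slash_invariant f.holo' (levelOne_slash_eq f γ))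
    (Derivative.serreDerivative_mdifferentiable k f.holo') (isBoundedAtImInfty_serreDerivative f)

/-- **The `q`-expansion of the Serre derivative**:
`∂_k f = ∑_m (m f̂(m) − (k/12) ∑_{i+j=m} ê(i) f̂(j)) q^m`, where `ê` are the coefficients of
`E₂` (`D = θ` on `q`-series and products are Cauchy products). [folklore] -/
theorem hasSum_serreDerivative {k : ℤ} (f : ModularForm 𝒮ℒ k) (τ : ℍ) :
    HasSum (fun m : ℕ => ((m : ℂ) * (qExpansion 1 f).coeff m -
        (k : ℂ) * 12⁻¹ * ∑ p ∈ antidiagonal m,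
          (if p.1 = 0 then 1 else -24 * (ArithmeticFunction.sigma 1 p.1 : ℂ)) *
            (qExpansion 1 f).coeff p.2) * Function.Periodic.qParam 1 (τ : ℂ) ^ m)
      (Derivative.serreDerivative k f τ) := by
  have hD := hasSum_normalizedDeriv_of_hasSum_qParam (hasSum_qExpansion_levelOne f) τ
  have hP := hasSum_mul_of_hasSum_qParam hasSum_E2_qParam (hasSum_qExpansion_levelOne f) τ
  have h := hD.sub (hP.mul_left ((k : ℂ) * 12⁻¹))
  have hfun : (fun m : ℕ => ((m : ℂ) * (qExpansion 1 f).coeff m -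
        (k : ℂ) * 12⁻¹ * ∑ p ∈ antidiagonal m,
          (if p.1 = 0 then 1 else -24 * (ArithmeticFunction.sigma 1 p.1 : ℂ)) *
            (qExpansion 1 f).coeff p.2) * Function.Periodic.qParam 1 (τ : ℂ) ^ m) =
      fun m : ℕ => (m : ℂ) * (qExpansion 1 f).coeff m * Function.Periodic.qParam 1 (τ : ℂ) ^ m -
        (k : ℂ) * 12⁻¹ * ((∑ p ∈ antidiagonal m,
          (if p.1 = 0 then 1 else -24 * (ArithmeticFunction.sigma 1 p.1 : ℂ)) *
            (qExpansion 1 f).coeff p.2) * Function.Periodic.qParam 1 (τ : ℂ) ^ m) := by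
    funext m; ring
  have hval : Derivative.serreDerivative k f τ =
      Derivative.normalizedDerivOfComplex f τ - (k : ℂ) * 12⁻¹ * (E2 τ * f τ) := by
    rw [Derivative.serreDerivative_apply]; ring
  rw [hfun, hval]
  exact h

/-! ### Coefficients in a one-dimensional weight -/

/-- **In a weight with `dim M_k(SL₂(ℤ)) = 1`, containing a form `h` with constant term `1`,
every form `g` has `ĝ(m) = ĝ(0) · ĥ(m)`** (`g = c h` and `c = ĝ(0)`). [folklore] -/
theorem qExpansion_coeff_eq_mul_of_rank_one {k : ℤ} (hrank : Module.rank ℂ (ModularForm 𝒮ℒ k) = 1)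
    (h : ModularForm 𝒮ℒ k) (hh0 : (qExpansion 1 h).coeff 0 = 1) (g : ModularForm 𝒮ℒ k) (m : ℕ) :
    (qExpansion 1 g).coeff m = (qExpansion 1 g).coeff 0 * (qExpansion 1 h).coeff m := by
  have hh : h ≠ 0 := by
    intro h0
    rw [h0] at hh0
    simp [UpperHalfPlane.qExpansion_zero] at hh0
  obtain ⟨c, hc⟩ := (finrank_eq_one_iff_of_nonzero' h hh).mp
    (Module.rank_eq_one_iff_finrank_eq_one.mp hrank) g
  have hq : qExpansion 1 g = c • qExpansion 1 h := by
    rw [← hc, IsGLPos.coe_smul]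
    exact ModularForm.qExpansion_smul one_pos one_mem_strictPeriods_SL c h
  have hcm : ∀ n, (qExpansion 1 g).coeff n = c * (qExpansion 1 h).coeff n := fun n => by
    rw [hq, PowerSeries.coeff_smul, smul_eq_mul]
  rw [hcm m, hcm 0, hh0, mul_one]

end Literature.Barriers.Schanuel

end
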